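import Literature.AlgebraicGeometry.Markman2025.WeilHermitianFormSignature

/-!
# Markman 2023 (JEMS 25) — DEFINITION 12.10 and LEMMA 12.11 («The Hermitian forms of the abelian fourfolds of Weil
# type in Corollary 12.9 all have trivial discriminants»): the closing computation of the printed proof, AS PRINTED,
# kernel-checked in the operator model of `CliffordPairWeilPolarization.lean`

E. Markman: [M23] *The monodromy of generalized Kummer varieties and algebraic cycles on their intermediate Jacobians*,
J. Eur. Math. Soc. 25 (2023) 231–321, doi 10.4171/jems/1199 — REFEREED; bib `Markman2023GeneralizedKummers`. Numbering
and wording = arXiv:1805.11574 **v4** (PDF sha256/16 `8e695d427eba6593`, re-fetched by read-only GET), whose item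
numbers agree with the JEMS numbers of record (Def 12.10, Lemma 12.11 — JEMS pp. 302–303; lit-2 gen-9,
`HOME/lit/LIT2-WEIL.md` §BD); «v4 p. N L m» = PyMuPDF line `m` of page `N` of that PDF, text layer extracted and the
displays of p. 67 L64–93 and p. 68 L43–69 read BY EYE at seat lit-w-markman g21 (pub-hsemireg LIT-W, 2026-08-25) on the
160-dpi renders `r_mar23v4_p67_L64-93.png` (`8e74ec90ad96ce3a`) and `r_mar23v4_p68_L43-69.png` (`c5a58af48bbe8ab3`)
in `HOME/lit/Markman-renders-litw-markman-g21/`. `CliffordPairWeilPolarization.lean` (LEAN #30 of the lineage) takes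
«DEFINITION 12.10 … and LEMMA 12.11 … BY VALUE»; this leaf supplies the kernel leg of the part of Lemma 12.11's proof
that IS displayed linear algebra — the last eleven lines — and leaves the lattice-theoretic part BY VALUE.

## What is printed (verbatim, by eye)

* v4 p. 67 L64–81 (JEMS p. 302–303): «We recall next a discrete isogeny invariant of abelian varieties of Weil type. Set
  `K := ℚ[√−d]`. Consider the map `H : V_ℚ ⊗ V_ℚ → K`, given by (12.9)
  `H(x, y) := Θ_h(x, Θ′_h(y)) + √−dΘ_h(x, y) = d(x, y) + √−d(Θ′_h(x), y)`. `H` is a non-degenerate Hermitian form on the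
  4-dimensional `K`-vector space `V_ℚ`, by [vG1, Lemma 5.2]. Choose a `K`-basis `β := {x₁, x₂, x₃, x₄}` of `V_ℚ` and
  denote by `Ψ := (H(x_i, x_j))` the Hermitian matrix of `H` with respect to `β`.» DEFINITION 12.10: «The discriminant
  `det H` of `H` is the image of `det(Ψ)` in `ℚ^*/Nm(K^*)`.» «The discriminant `det H` is independent of the choice of
  `β`, by [vG1, Lemma 5.2(3)].» LEMMA 12.11: «The Hermitian forms of the abelian fourfolds of Weil type in Corollary 12.9
  all have trivial discriminants.»
* Proof, v4 p. 67 L84 – p. 68 L42: the lattice/representation-theoretic construction (Nikulin [Ni, Theorem 1.14.4],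
  `S⁺ ≅ U^{⊕4}`, `U₁ ⊕ U₂ ⊂ {w, h}^⊥`, the involutions `η_i := m_{e_i} ∘ m_{f_i}` with (12.10) `(η_i(x), η_i(x)) = −(x, x)`,
  the isotropic subspaces `L_{z_i}`, `L_{y_j}` [Ch], the one-dimensional `K`-subspaces `L_{z_i,y_j}`, «both `(•, •)_V` and `H`
  induce a non-degenerate bilinear pairing between `L_{z_i,y_j}` and `L_{z_î,y_ĵ}`») — BY VALUE here. «In this proof
  `(•, •)_V` will be denoted by `(•, •)`» (p. 68 L8).
* Proof, v4 p. 68 L43–69 (the part kernel-checked below): «Let `a ∈ L_{z₁,y₁}` and `b ∈ L_{z₂,y₂}` be elements satisfying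
  `(a, b) ≠ 0` and `(a, Θ′_h(b)) = 0`. Note that `(a, a) = 0 = (b, b)`. Set `x₁ := a + b` and `x₂ = a − b`. Then
  `(x₁, x₂) = 0`, `(x₁, x₁) = 2(a, b) = −(x₂, x₂)`, and
  `H(x₁, x₂) = d(x₁, x₂) + √−d(Θ′_h(x₁), x₂) = −2√−d(a, Θ′_h(b)) = 0`.
  Choose `a′ ∈ L_{z₁,y₂}` and `b′ ∈ L_{z₂,y₁}` satisfying `(a′, b′) ≠ 0` and `(a′, Θ′_h(b′)) = 0`. Then
  `(x₃, x₃) = 2(a′, b′) = −(x₄, x₄)` and `H(x₃, x₄) = 0`. We conclude that `β := {x₁, x₂, x₃, x₄}` is an `H`-orthogonal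
  `K`-basis for `V_ℚ` and the `β`-matrix `Ψ` of `H` satisfies
  `det(Ψ) = ∏_{i=1}^{4} H(x_i, x_i) = d⁴ ∏_{i=1}^{4} (x_i, x_i) = d⁴(x₁, x₁)²(x₃, x₃)² ∈ (ℚ^*)²`.»

## What this file proves (kernel-checked; theorems only — no def, no named fact, no sorry)

MODEL = that of `CliffordPairWeilPolarization.lean` §B–§C: `F` a field (`ℚ`; `2 ≠ 0` where used), `M` an `F`-space
(`V_ℚ`), `B = (•, •)` a bilinear form, SYMMETRIC where used (`hB`), `T = Θ′_h` ANTI-SELF-DUAL for `B` (`hT`, §12.2),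
`d : F`, `K = F(√−d) =` Mathlib `QuadraticAlgebra F (−d) 0` (`HermitianForm312.Kd F d`), and
`H = Literature.AlgebraicGeometry.Markman2025.HermitianForm312.H B T d` — which IS (12.9) by `CliffordPairWeil129.eq129`
(this leaf imports only `Markman2025/WeilHermitianFormSignature.lean`, the home of the model `H`, `Kd`; the one input
taken from §12.2, `(Θ′x, x) = 0`, is re-derived as a private helper — cf. `CliffordPairWeil129.theta_alternating`).
The basis `β` is a function `x : Fin 4 → M` (`x 0, x 1, x 2, x 3` for `x₁, x₂, x₃, x₄`); `Ψ = Matrix.of (H(x_i, x_j))`.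
§A (`x₁ := a + b`, `x₂ = a − b` with `(a,a) = 0 = (b,b)`): `pair_x1_x2` («`(x₁, x₂) = 0`»), `self_x1`, `self_x2`
(«`(x₁, x₁) = 2(a, b) = −(x₂, x₂)`»), `thetaPair_x1_x2` and `H_x1_x2` («`H(x₁, x₂) = d(x₁, x₂) + √−d(Θ′_h(x₁), x₂) =
∓2√−d(a, Θ′_h(b))`» — PRINT-READING PRECISION P-12.11, recorded not resolved: with `Θ′_h` anti-self-dual as printed in
§12.2, `(Θ′_h(x₁), x₂) = +2(a, Θ′_h(b))`; the print shows `−2`; either way the term VANISHES by the choice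
`(a, Θ′_h(b)) = 0`, which is all the proof uses — `H_x1_x2_eq_zero`), and the same for `x₃, x₄` (same theorems with
`a′, b′`). §B: `H_self` («`H(x_i, x_i) = d(x_i, x_i)`», in `K`), `gram_eq_diagonal` ∕ `det_gram_eq_prod` («`β` is
`H`-orthogonal … `det(Ψ) = ∏ H(x_i, x_i)`», any finite index type), `prod_H_self` («`= d⁴ ∏ (x_i, x_i)`»),
`prod_self_eq_sq` («`= d⁴(x₁, x₁)²(x₃, x₃)²`» from «`(x₁, x₁) = −(x₂, x₂)`», «`(x₃, x₃) = −(x₄, x₄)`»), `det_gram_eq_sq`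
(the whole display), and the conclusion «`∈ (ℚ^*)²`» ⟹ TRIVIAL DISCRIMINANT (DEFINITION 12.10: trivial in `F^*/Nm(K^*)`):
`det(Ψ) = Nm(z)` for the NONZERO `z = d²(x₁, x₁)(x₃, x₃) ∈ F ⊂ K` and `det(Ψ) ≠ 0` (`det_gram_eq_norm`,
`lemma1211_trivialDiscriminant`; squares of `F^*` are norms, Mathlib `QuadraticAlgebra.norm_algebraMap`).
BY VALUE / NOT formalised: everything in the proof before p. 68 L43 (listed above), the existence of `a, b, a′, b′`, that
`β` is a `K`-basis, [vG1, Lemma 5.2], independence of `det H` from `β`. Honest framing (pub-hsemireg, TABLE row M-Mk8 /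
W4 «lattice-first» bookkeeping: the discriminant invariant of Weil type): printed linear algebra re-checked; nothing here
bears on the Hodge conjecture or re-proves Lemma 12.11.
-/

namespace Literature.AlgebraicGeometry.HodgeTheory

namespace CliffordPairWeil1211

open QuadraticAlgebra Literature.AlgebraicGeometry.Markman2025 Literature.AlgebraicGeometry.Markman2025.HermitianForm312

variable {F : Type*} [Field F] {M : Type*} [AddCommGroup M] [Module F M]
variable (B : M →ₗ[F] M →ₗ[F] F) (T : M →ₗ[F] M) (d : F)

/-! ### §A — v4 p. 68 L43–54: `x₁ := a + b`, `x₂ = a − b` -/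

section IsotropicPair

variable {a b : M}

/-- «Note that `(a, a) = 0 = (b, b)`. Set `x₁ := a + b` and `x₂ = a − b`. Then `(x₁, x₂) = 0`» (`B` symmetric).
[cite: Markman2023GeneralizedKummers, Lemma 12.11 (proof), JEMS 25 (2023) p. 303; arXiv v4 p. 68 L46] -/
theorem pair_x1_x2 (hB : ∀ x y, B x y = B y x) (ha : B a a = 0) (hb : B b b = 0) : B (a + b) (a - b) = 0 := by
  simp only [map_add, map_sub, LinearMap.add_apply, ha, hb, hB b a]
  ring

/-- «`(x₁, x₁) = 2(a, b)`». [cite: Markman2023GeneralizedKummers, Lemma 12.11 (proof), JEMS 25 (2023) p. 303; arXiv v4 p. 68 L47] -/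
theorem self_x1 (hB : ∀ x y, B x y = B y x) (ha : B a a = 0) (hb : B b b = 0) : B (a + b) (a + b) = 2 * B a b := by
  simp only [map_add, LinearMap.add_apply, ha, hb, hB b a]
  ring

/-- «`… = −(x₂, x₂)`»: `(x₂, x₂) = −2(a, b)`, so `(x₁, x₁) = −(x₂, x₂)`.
[cite: Markman2023GeneralizedKummers, Lemma 12.11 (proof), JEMS 25 (2023) p. 303; arXiv v4 p. 68 L47] -/
theorem self_x2 (hB : ∀ x y, B x y = B y x) (ha : B a a = 0) (hb : B b b = 0) :
    B (a - b) (a - b) = -(2 * B a b) ∧ B (a + b) (a + b) = -B (a - b) (a - b) := by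
  have h2 : B (a - b) (a - b) = -(2 * B a b) := by
    simp only [map_sub, LinearMap.sub_apply, ha, hb, hB b a]
    ring
  exact ⟨h2, by rw [self_x1 B hB ha hb, h2, neg_neg]⟩

/-- `(Θ′x, x) = 0` for `Θ′` anti-self-dual, `(•, •)` symmetric and `2 ≠ 0` («An anti-self-dual homomorphism is sent by
`a` to `∧²V^*`», §12.2; = `CliffordPairWeil129.theta_alternating`, re-derived); private helper. [folklore] -/
private theorem theta_self_eq_zero (hB : ∀ x y, B x y = B y x) (hT : ∀ x y, B (T x) y = -B x (T y)) (h2 : (2 : F) ≠ 0)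
    (x : M) : B (T x) x = 0 := by
  have h : B (T x) x = -B (T x) x :=
    calc B (T x) x = -B x (T x) := hT x x
      _ = -B (T x) x := by rw [hB x (T x)]
  have h' : (2 : F) * B (T x) x = 0 := by linear_combination h
  exact (mul_eq_zero.mp h').resolve_left h2

/-- The `√−d`-coefficient of `H(x₁, x₂)`: «`√−d(Θ′_h(x₁), x₂)`» equals `2√−d·(a, Θ′_h(b))` for `Θ′_h` anti-self-dual and
`(•, •)` symmetric (`(Θ′a, a) = 0 = (Θ′b, b)` when `2 ≠ 0`). PRINT-READING
PRECISION P-12.11: the print shows «`−2√−d(a, Θ′_h(b))`»; with the anti-self-duality `(Θ′x, y) = −(x, Θ′y)` of §12.2 the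
coefficient is `+2`; nothing downstream moves (the term is `0` by the choice of `a, b`).
[cite: Markman2023GeneralizedKummers, Lemma 12.11 (proof), JEMS 25 (2023) p. 303; arXiv v4 p. 68 L48–54] -/
theorem thetaPair_x1_x2 (hB : ∀ x y, B x y = B y x) (hT : ∀ x y, B (T x) y = -B x (T y)) (h2 : (2 : F) ≠ 0) :
    B (T (a + b)) (a - b) = 2 * B a (T b) := by
  have halt := theta_self_eq_zero B T hB hT h2
  simp only [map_add, map_sub, LinearMap.add_apply, halt a, halt b]
  rw [hT a b, show B (T b) a = B a (T b) from hB (T b) a]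
  ring

/-- «`H(x₁, x₂) = d(x₁, x₂) + √−d(Θ′_h(x₁), x₂) = ∓2√−d(a, Θ′_h(b))`» in `K = F(√−d)`: real part `d·(x₁, x₂) = 0`,
`√−d`-coefficient `2(a, Θ′_h(b))` (P-12.11 above).
[cite: Markman2023GeneralizedKummers, Lemma 12.11 (proof), JEMS 25 (2023) p. 303; arXiv v4 p. 68 L48–54] -/
theorem H_x1_x2 (hB : ∀ x y, B x y = B y x) (hT : ∀ x y, B (T x) y = -B x (T y)) (h2 : (2 : F) ≠ 0)
    (ha : B a a = 0) (hb : B b b = 0) : H B T d (a + b) (a - b) = (⟨0, 2 * B a (T b)⟩ : Kd F d) := by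
  ext
  · rw [H_re, pair_x1_x2 B hB ha hb, mul_zero]
  · rw [H_im, thetaPair_x1_x2 B T hB hT h2]

/-- «`… = 0`» — by the choice «`(a, Θ′_h(b)) = 0`»: `x₁, x₂` are `H`-orthogonal. (The same theorem with `a′, b′` gives
«`H(x₃, x₄) = 0`».) [cite: Markman2023GeneralizedKummers, Lemma 12.11 (proof), JEMS 25 (2023) p. 303; arXiv v4 p. 68 L43–58] -/
theorem H_x1_x2_eq_zero (hB : ∀ x y, B x y = B y x) (hT : ∀ x y, B (T x) y = -B x (T y)) (h2 : (2 : F) ≠ 0)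
    (ha : B a a = 0) (hb : B b b = 0) (hab : B a (T b) = 0) : H B T d (a + b) (a - b) = 0 := by
  rw [H_x1_x2 B T d hB hT h2 ha hb, hab, mul_zero]
  rfl

/-- And `H(x₂, x₁) = 0` as well (`H` is Hermitian, `HermitianForm312.hermitian_symm`), so the `2 × 2` block of `Ψ` on
`{x₁, x₂}` is diagonal. [cite: Markman2023GeneralizedKummers, Lemma 12.11 (proof), JEMS 25 (2023) p. 303; arXiv v4 p. 68 L59–60] -/
theorem H_x2_x1_eq_zero (hB : ∀ x y, B x y = B y x) (hT : ∀ x y, B (T x) y = -B x (T y)) (h2 : (2 : F) ≠ 0)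
    (ha : B a a = 0) (hb : B b b = 0) (hab : B a (T b) = 0) : H B T d (a - b) (a + b) = 0 := by
  rw [hermitian_symm B T d hB hT, H_x1_x2_eq_zero B T d hB hT h2 ha hb hab, star_zero]

end IsotropicPair

/-! ### §B — v4 p. 68 L59–69: `det(Ψ) = ∏ H(x_i, x_i) = d⁴ ∏ (x_i, x_i) = d⁴(x₁, x₁)²(x₃, x₃)² ∈ (ℚ^*)²` -/

section Determinant

/-- `H(x, x) = d(x, x)` in `K`: real part `d(x, x)` and `√−d`-coefficient `(Θ′x, x) = 0` (`2 ≠ 0`) — the step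
«`∏ H(x_i, x_i) = d⁴ ∏ (x_i, x_i)`» termwise. [cite: Markman2023GeneralizedKummers, Lemma 12.11 (proof), JEMS 25 (2023) p. 303; arXiv v4 p. 68 L61–69] -/
theorem H_self (hB : ∀ x y, B x y = B y x) (hT : ∀ x y, B (T x) y = -B x (T y)) (h2 : (2 : F) ≠ 0) (x : M) :
    H B T d x x = algebraMap F (Kd F d) (d * B x x) := by
  rw [algebraMap_eq]
  ext
  · exact re_self B T d x
  · exact im_self B T d hB hT h2 x

variable {ι : Type*} [Fintype ι] [DecidableEq ι]

omit [Fintype ι] in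
/-- «`β := {x₁, x₂, x₃, x₄}` is an `H`-orthogonal `K`-basis … and the `β`-matrix `Ψ` of `H`» is then DIAGONAL:
`Ψ = (H(x_i, x_j)) = diag(H(x_i, x_i))`. [cite: Markman2023GeneralizedKummers, Lemma 12.11 (proof) with Definition 12.10, JEMS 25 (2023) pp. 302–303; arXiv v4 p. 67 L78–80, p. 68 L59–61] -/
theorem gram_eq_diagonal (x : ι → M) (horth : ∀ i j, i ≠ j → H B T d (x i) (x j) = 0) :
    (Matrix.of fun i j => H B T d (x i) (x j)) = Matrix.diagonal fun i => H B T d (x i) (x i) := by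
  funext i j
  by_cases hij : i = j
  · subst hij; simp
  · rw [Matrix.of_apply, Matrix.diagonal_apply_ne _ hij, horth i j hij]

/-- «`det(Ψ) = ∏_{i=1}^{4} H(x_i, x_i)`» for an `H`-orthogonal `β`.
[cite: Markman2023GeneralizedKummers, Lemma 12.11 (proof), JEMS 25 (2023) p. 303; arXiv v4 p. 68 L61–65] -/
theorem det_gram_eq_prod (x : ι → M) (horth : ∀ i j, i ≠ j → H B T d (x i) (x j) = 0) :
    (Matrix.of fun i j => H B T d (x i) (x j)).det = ∏ i, H B T d (x i) (x i) := by
  rw [gram_eq_diagonal B T d x horth, Matrix.det_diagonal]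

omit [DecidableEq ι] in
/-- «`∏ H(x_i, x_i) = d⁴ ∏ (x_i, x_i)`» (`d^{#β}` for a basis of any finite size; `#β = 4` printed).
[cite: Markman2023GeneralizedKummers, Lemma 12.11 (proof), JEMS 25 (2023) p. 303; arXiv v4 p. 68 L61–69] -/
theorem prod_H_self (hB : ∀ x y, B x y = B y x) (hT : ∀ x y, B (T x) y = -B x (T y)) (h2 : (2 : F) ≠ 0)
    (x : ι → M) : ∏ i, H B T d (x i) (x i) = algebraMap F (Kd F d) (d ^ Fintype.card ι * ∏ i, B (x i) (x i)) := by
  simp only [H_self B T d hB hT h2, ← map_prod, Finset.prod_mul_distrib, Finset.prod_const, Finset.card_univ]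

/-- «`d⁴ ∏ (x_i, x_i) = d⁴(x₁, x₁)²(x₃, x₃)²`» — from «`(x₁, x₁) = −(x₂, x₂)`» and «`(x₃, x₃) = −(x₄, x₄)`»
(`x 0, x 1, x 2, x 3` for `x₁, …, x₄`). [cite: Markman2023GeneralizedKummers, Lemma 12.11 (proof), JEMS 25 (2023) p. 303; arXiv v4 p. 68 L47, L58, L65–69] -/
theorem prod_self_eq_sq (x : Fin 4 → M) (h12 : B (x 0) (x 0) = -B (x 1) (x 1)) (h34 : B (x 2) (x 2) = -B (x 3) (x 3)) :
    d ^ 4 * ∏ i, B (x i) (x i) = d ^ 4 * (B (x 0) (x 0) ^ 2 * B (x 2) (x 2) ^ 2) := by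
  have h1 : B (x 1) (x 1) = -B (x 0) (x 0) := by rw [h12, neg_neg]
  have h3 : B (x 3) (x 3) = -B (x 2) (x 2) := by rw [h34, neg_neg]
  simp only [Fin.prod_univ_four, h1, h3]
  ring

/-- The whole display: «`det(Ψ) = ∏ H(x_i, x_i) = d⁴ ∏ (x_i, x_i) = d⁴(x₁, x₁)²(x₃, x₃)²`» — for an `H`-orthogonal
`β = {x₁, x₂, x₃, x₄}` with `(x₁, x₁) = −(x₂, x₂)`, `(x₃, x₃) = −(x₄, x₄)`; and `d⁴(x₁, x₁)²(x₃, x₃)² = (d²(x₁, x₁)(x₃, x₃))²`.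
[cite: Markman2023GeneralizedKummers, Lemma 12.11 (proof), JEMS 25 (2023) p. 303; arXiv v4 p. 68 L59–69] -/
theorem det_gram_eq_sq (hB : ∀ x y, B x y = B y x) (hT : ∀ x y, B (T x) y = -B x (T y)) (h2 : (2 : F) ≠ 0)
    (x : Fin 4 → M) (horth : ∀ i j, i ≠ j → H B T d (x i) (x j) = 0) (h12 : B (x 0) (x 0) = -B (x 1) (x 1))
    (h34 : B (x 2) (x 2) = -B (x 3) (x 3)) :
    (Matrix.of fun i j => H B T d (x i) (x j)).det =
      algebraMap F (Kd F d) ((d ^ 2 * B (x 0) (x 0) * B (x 2) (x 2)) ^ 2) := by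
  rw [det_gram_eq_prod B T d x horth, prod_H_self B T d hB hT h2, Fintype.card_fin, prod_self_eq_sq B d x h12 h34]
  congr 1
  ring

/-- «`∈ (ℚ^*)²`» ⟹ the image of `det(Ψ)` in `F^*/Nm(K^*)` is TRIVIAL (DEFINITION 12.10): a nonzero square of `F` is a
norm from `K = F(√−d)` — `det(Ψ) = Nm(z)` with `z := d²(x₁, x₁)(x₃, x₃) ∈ F ⊂ K` (Mathlib `QuadraticAlgebra.norm_algebraMap`:
`Nm(c) = c²` for `c ∈ F`). [cite: Markman2023GeneralizedKummers, Definition 12.10 and Lemma 12.11 (proof), JEMS 25 (2023) pp. 302–303; arXiv v4 p. 67 L80, p. 68 L69] -/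
theorem det_gram_eq_norm (hB : ∀ x y, B x y = B y x) (hT : ∀ x y, B (T x) y = -B x (T y)) (h2 : (2 : F) ≠ 0)
    (x : Fin 4 → M) (horth : ∀ i j, i ≠ j → H B T d (x i) (x j) = 0) (h12 : B (x 0) (x 0) = -B (x 1) (x 1))
    (h34 : B (x 2) (x 2) = -B (x 3) (x 3)) :
    (Matrix.of fun i j => H B T d (x i) (x j)).det =
      algebraMap F (Kd F d) (QuadraticAlgebra.norm (algebraMap F (Kd F d) (d ^ 2 * B (x 0) (x 0) * B (x 2) (x 2)))) := by
  rw [det_gram_eq_sq B T d hB hT h2 x horth h12 h34, QuadraticAlgebra.norm_algebraMap]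

/-- LEMMA 12.11's conclusion in the model («trivial discriminants»): for `β` as in the proof — `H`-orthogonal, with
`(x₁, x₁) = 2(a, b) ≠ 0` [i.e. `(a, b) ≠ 0`], `(x₃, x₃) = 2(a′, b′) ≠ 0`, `(x₁, x₁) = −(x₂, x₂)`, `(x₃, x₃) = −(x₄, x₄)` —
and `d ≠ 0`, the determinant `det(Ψ)` is the norm of a NONZERO element of `K` (indeed of `F^* ⊂ K^*`), hence
`det(Ψ) ≠ 0` and its class in `F^*/Nm(K^*)` is the identity.
[cite: Markman2023GeneralizedKummers, Lemma 12.11, JEMS 25 (2023) p. 303; arXiv v4 p. 67 L82–83, p. 68 L43–69] -/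
theorem lemma1211_trivialDiscriminant (hB : ∀ x y, B x y = B y x) (hT : ∀ x y, B (T x) y = -B x (T y))
    (h2 : (2 : F) ≠ 0) (hd : d ≠ 0) (x : Fin 4 → M) (horth : ∀ i j, i ≠ j → H B T d (x i) (x j) = 0)
    (h12 : B (x 0) (x 0) = -B (x 1) (x 1)) (h34 : B (x 2) (x 2) = -B (x 3) (x 3)) (h1 : B (x 0) (x 0) ≠ 0)
    (h3 : B (x 2) (x 2) ≠ 0) :
    ∃ z : Kd F d, z ≠ 0 ∧
      (Matrix.of fun i j => H B T d (x i) (x j)).det = algebraMap F (Kd F d) (QuadraticAlgebra.norm z) ∧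
      (Matrix.of fun i j => H B T d (x i) (x j)).det ≠ 0 := by
  have hz : d ^ 2 * B (x 0) (x 0) * B (x 2) (x 2) ≠ 0 := mul_ne_zero (mul_ne_zero (pow_ne_zero 2 hd) h1) h3
  refine ⟨algebraMap F (Kd F d) (d ^ 2 * B (x 0) (x 0) * B (x 2) (x 2)), ?_,
    det_gram_eq_norm B T d hB hT h2 x horth h12 h34, ?_⟩
  · exact fun h => hz (algebraMap_injective (by rwa [map_zero]))
  · rw [det_gram_eq_sq B T d hB hT h2 x horth h12 h34]
    exact fun h => pow_ne_zero 2 hz (algebraMap_injective (by rwa [map_zero]))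

end Determinant

/-! ### Numerals (sanity instance; `example`s carry no tag)

With `F = ℚ`, `d = 3`, `(x₁, x₁) = 2`, `(x₃, x₃) = −4`: `d⁴(x₁, x₁)²(x₃, x₃)² = 81·4·16 = 5184 = 72² = Nm(72)`. -/

example : (3 : ℚ) ^ 4 * (2 ^ 2 * (-4) ^ 2) = (3 ^ 2 * 2 * (-4)) ^ 2 := by norm_num
example : QuadraticAlgebra.norm (algebraMap ℚ (Kd ℚ 3) 72) = 5184 := by
  rw [QuadraticAlgebra.norm_algebraMap]; norm_num

end CliffordPairWeil1211

end Literature.AlgebraicGeometry.HodgeTheory
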